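import Summits.BirchSwinnertonDyer.BirchSwinnertonDyer.Theorems.KolyvaginRoadThreeCruxIffLeaf
import Summits.BirchSwinnertonDyer.BirchSwinnertonDyer.Theorems.ClassRecordThreeRegCertRows08
import Summits.BirchSwinnertonDyer.BirchSwinnertonDyer.Theorems.Rank1ResidualIntModelReduction
import Summits.BirchSwinnertonDyer.BirchSwinnertonDyer.Theses.ClassRecordThree
import Summits.BirchSwinnertonDyer.Rank1Residual.X11b.Three.ClassRecordAtThree
import HarnessLib

/-!
# Route `KolyvaginRoadThree`, crux `ZhangSharpFrameAtThreeHL` (item stmt-BirchSwinnertonDyer-19574), registered stub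
# `stub_zhangFrameHL_nonsplit` (SkeletonHL-v3, sha16 0af9c6aecc218332): the NON-SPLIT half of Kolyvagin's conjecture
# mod 3 on A1 REDUCES, by name, to the sister route's crux `ClassRecordThree.SchneiderAtThree` (item 19106) plus the
# published inputs; and the BC5 rung `stub_rung_347253a1` from the published inputs ALONE
# (cell `bsd-stepL`, seat `bsd-stepL-koly3b` (PART 1b ACCEL seat (10)); `--supports stmt-BirchSwinnertonDyer-19574`, helper)

HONEST FRAMING. BSD is not proved by any of this; Kolyvagin's conjecture mod 3 at `3 ∥ N` (the crux) is asserted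
nowhere; Schneider's non-degeneracy conjecture (the content of `SchneiderAtThree`, barrier
`Literature.Barriers.BirchSwinnertonDyer.PAdicHeightNondegeneracy`) is asserted nowhere; every published input is a
named fact of the tree taken as a binder. THEOREMS ONLY (0 definitions, 0 named facts, 0 `sorry`). PARTITION: O2@3 (B10)
× A1 ∩ NON-SPLIT(3) — types-the-object-of; closes: none (the registered stub is concluded only CONDITIONALLY).

THE POINT («Skinner–Zhang indivisibility at non-split 3, sign −1 local condition», director-bsd PART 1b row (10)).
Skinner–Zhang 2014 prove the indivisibility of Heegner points at a multiplicative `p ≥ 5` by the chain «main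
conjecture ⇒ `p`-part of the BSD formula ⇒ `p ∤ [E(K) : ℤ y_K]`-type index statements». At a NON-SPLIT multiplicative
`p = 3` the CYCLOTOMIC version of that chain is in print with `p = 3` INSIDE every printed range and with NO exceptional
zero (`a₃ = −1`: the factor `(1 − α_p⁻¹)` is the unit `2`, Skinner 2016 §3.2 «`· 1` otherwise»; Disegni 2020 Thm. 1 (∗)
void at a non-split prime) — this is the «sign −1» clause:

* road (a) of the class record at 3, `X11b.Three.bsdp_of_ram_of_nonsplit_of_regulatorNonvanishing`
  (`X11b/Three/ClassRecordAtThree.lean` §2): Skinner 2016 Thm. A («`p ≥ 3`», (irr) + (ram): the cyclotomic main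
  conjecture at `p ∥ N`) + Stein–Wuthrich 2013 Thm. 6.1 non-split («`p > 2`»: the algebraic leading term, GIVEN
  Schneider) + Disegni 2020 Thm. 1 (the analytic leading term at a non-split multiplicative prime) + GZK ⟹ `BSDp W 3`,
  for `(E,3) ∈` X11b, non-split at 3, (ram), PROVIDED `Reg₃(E) ≠ 0` (`ClassClosure.RegulatorNonvanishingAt W 3` — the
  predicate of crux `ClassRecordThree.SchneiderAtThree`, item 19106);
* zhang3-p1's converse `Koly.kolyvaginClass_one_ne_zero_of_bsdp_of_hlFrame` (`KolyvaginRoadThreeCruxIffLeaf.lean`,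
  p431973: `BSDp W 3` at an A1 curve FORCES a non-zero mod-3 Kolyvagin class at every Hoffstein–Luo frame, by STEP L +
  McCallum 1991 Cor. 5.6 in its divisibility half + the tower theorem).

Hence (§2) the registered stub `stub_zhangFrameHL_nonsplit` — its signature VERBATIM as conclusion — follows from the
route's published inputs (`PublishedInputsKolyThree`: Gross–Zagier, Kolyvagin, Skinner 2016 Thms A/C, GZK, modularity,
Stein–Wuthrich Thm. 6.1 + §4.2 height, Disegni 2020 Thm. 1, modular parametrisations, Shimura reciprocity at conductor 1)
+ Gross 1991 §3 ×2 + McCallum Cor. 5.6's divisibility half + `ClassRecordThree.SchneiderAtThree` BY NAME. In words: on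
A1 ∩ non-split(3) the crux of the Kolyvagin road carries NO open content beyond item 19106 of the sister route — its
residue there is Schneider's conjecture at 3, which the cell's REG3CERT programme certifies curve by curve IN THE KERNEL
(reg3-eng, `RegMult.Rows.rung_*`, 702 rows). And (§3) for Cremona 347253a1 — the BC5 rung of the skeleton, a NON-SPLIT
A1 curve with a kernel REG3CERT row (`RegMult.Rows.rung_347253a1`, batch 08) — the registered rung signature follows from
the published inputs ALONE: no attested Kolyvagin certificate (compare `Rung347253a1.rung_347253a1_of_cert`, which
carries koly's kit certificate j249662 as a hypothesis) and no analytic order of `Ш` (compare `…_of_shaAn_unit`); the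
only curve-specific input is the kernel arithmetic «non-split at 3» (`c₄ ≡ 1`, node-tangent quadratic `X² + 1`
irreducible over `𝔽₃`).

What this does NOT do: it does not prove the stub (Schneider at 3 is open class-wide); it says nothing on the SPLIT
locus (there the cyclotomic road meets the exceptional zero and the class record uses road (b), cruxes 19107/19108); it is
not W. Zhang's level-raising induction (koly METHOD skeleton v2) — it is the other door, and it is in print at `p = 3`.

* §1 `Koly.kolyvaginClass_one_ne_zero_at_hlFrame_of_nonsplit_of_regulatorNonvanishingAt` — ONE curve, ONE HL frame:
  PUB + `¬ split(3)` + `Reg₃(E) ≠ 0` ⟹ `∃ n d, c₁(n) ≠ 0`.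
  `Koly.kolyvaginClass_one_ne_zero_allHLFrames_of_regulatorRung` — ONE curve, ALL HL frames, from a REG3CERT-shaped
  rung `ClassX11b W 3 → Ram W 3 → ¬ split(3) → Reg₃ ≠ 0` (every kernel row `RegMult.Rows.rung_*` instantiates it).
* §2 `Theorems.stub_zhangFrameHL_nonsplit_of_schneiderAtThree` — the registered stub signature VERBATIM from PUB (as
  ∀-binders) + `ClassRecordThree.SchneiderAtThree`; `…_of_publishedInputsKolyThree_of_schneiderAtThree` — the same keyed
  on the route's own conjunction `PublishedInputsKolyThree` (+ the three Gross/McCallum facts it does not list).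
* §3 `Koly.Rung347253a1.not_hasSplitMultiplicativeReductionAtPrime_three` (kernel arithmetic) and
  `Koly.Rung347253a1.rung_347253a1_of_published` — the registered rung signature VERBATIM from PUB alone.

References (locators only): [cite: Skinner2016PacificMC, Thm. A (§1) and §3.2] [cite: SteinWuthrich2013, Thm. 6.1
(p. 20) and §4.2 (p. 15)] [cite: Disegni2020, Thm. 1 and Thm. 4] [cite: SkinnerZhang2014, Thm. 1.1 and §1 (the
mechanism «main conjecture ⇒ indivisibility»; p ≥ 5 there)] [cite: WZhang2014, Remark 5 and Thm. 10.2]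
[cite: McCallumLMS1991, §5 Lemma 5.1 and Cor. 5.6] [cite: GrossLMS1991, §3 (3.1)–(3.3), §4 (4.1)]
[cite: SilvermanAEC2009, VII.5 Prop. 5.1(b)] [cite: Miller2011LMS, Def. 1.1].
-/

noncomputable section

open scoped Classical

/-! ## §1 One curve, one Hoffstein–Luo frame -/

namespace Summit.BirchSwinnertonDyer.Rank1Residual.X11b.Three.Koly

open WeierstrassCurve NumberField Literature.NumberTheory.EllipticCurves
  Literature.NumberTheory.EllipticCurves.ModularForms
  Literature.NumberTheory.EllipticCurves.Rank1Residual
  Literature.NumberTheory.EllipticCurves.Skinner2016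
  Literature.NumberTheory.EllipticCurves.SteinWuthrich2013
  Literature.NumberTheory.EllipticCurves.Disegni2020
  Summit.BirchSwinnertonDyer.Rank1Residual Summit.BirchSwinnertonDyer.Rank1Residual.X11b

/-- **Kolyvagin's conjecture mod 3 at a Hoffstein–Luo frame of a NON-SPLIT A1 curve, from the published inputs and
Schneider's non-degeneracy at the pair** (the cyclotomic door; «sign −1»: no exceptional zero at a non-split 3).
Data: `W/ℚ` globally minimal, `(E,3) ∈` X11b, NON-split multiplicative at `3`, a (ram) witness, `3 ∤ ∏ c_ℓ`; `K`
imaginary quadratic with `d_K` odd, Heegner for `N_E`, `L(E^{d_K},1) ≠ 0`; a frame `(Dt, β, ι)` with `4N ∣ β² − d_K`,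
`3 ∤ c(Dt)`. PUBLISHED inputs as binders: the nine of zhang3-p1's converse (`hGZ hKo hSk hGZK hmod hrec h1 h2 hMcU`)
and road (a)'s five (Skinner 2016 Thm. A `hSkA`, Stein–Wuthrich Thm. 6.1 non-split `hJn`, the §4.2 height `hHn`,
Disegni 2020 Thm. 1 `hD`, parametrisations `hpar`). OPEN input: `ClassClosure.RegulatorNonvanishingAt W 3` (Schneider
at the pair; crux 19106's predicate). Proof: road (a) gives `BSDp W 3`; the converse returns the class. CONDITIONAL on
every binder; nothing is booked. [cite: Skinner2016PacificMC, Thm. A (§1), §3.2] [cite: SteinWuthrich2013, Thm. 6.1]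
[cite: Disegni2020, Thm. 1] [cite: McCallumLMS1991, §5 Lemma 5.1 and Cor. 5.6] [cite: WZhang2014, Remark 5 and Thm. 10.2] -/
theorem kolyvaginClass_one_ne_zero_at_hlFrame_of_nonsplit_of_regulatorNonvanishingAt
    (W : WeierstrassCurve ℚ) [W.IsElliptic] [W.IsGloballyMinimal] [NeZero (W.conductorNorm ℤ)]
    (K : Type) [Field K] [NumberField K]
    (Dt : ModularParametrizationData W (W.conductorNorm ℤ)) (β : ℤ) (ι : K →+* ℂ)
    -- published inputs: the converse's nine
    (hGZ : gross_zagier (W.conductorNorm ℤ) W K) (hKo : kolyvagin (W.conductorNorm ℤ) W K)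
    (hSk : thmC_padicValRat_bsd_rank_zero)
    (hGZK : rank_eq_analyticRank_of_analyticRank_le_one) (hmod : hasEntireLFunction_rat)
    (hrec : heegnerPointOfConductor_one_galoisConj (W.conductorNorm ℤ) W K)
    (h1 : phi_heegnerPointOfConductor_mem_range_map_ringClassField (W.conductorNorm ℤ) W K)
    (h2 : exists_generator_ringClassGalOver K)
    (hMcU : McCallum1991_padicValNat_card_sha_primary_add_le_of_globalDivisibility)
    -- published inputs: road (a)'s five
    (hSkA : thmA_charIdeal_multiplicative) (hJn : thm61_nonsplitMultiplicative) (hHn : exists_isMultCanonical)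
    (hD : thm1_padicBSD_rankOne_multiplicative) (hpar : nonempty_modularParametrizationData)
    -- the pair (A1, non-split at 3) and the HL frame
    (hX : ClassX11b W 3) (hns : ¬ W.HasSplitMultiplicativeReductionAtPrime 3) (hram : Ram W 3)
    (htam : ¬ 3 ∣ W.tamagawaProduct)
    (hK : IsImaginaryQuadratic K) (hodd : Odd (NumberField.discr K))
    (hH : SatisfiesHeegnerHypothesis (W.conductorNorm ℤ) K)
    (hLt : (W.quadraticTwist (NumberField.discr K : ℚ)).entireLFunction 1 ≠ 0)
    (hβ : (4 * (W.conductorNorm ℤ : ℤ)) ∣ β ^ 2 - NumberField.discr K) (hc : ¬ (3 : ℤ) ∣ Dt.c)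
    -- THE OPEN INPUT: Schneider's non-degeneracy at (E, 3)
    (hReg : ClassClosure.RegulatorNonvanishingAt W 3) :
    ∃ (n : ℕ) (d : KolyvaginHeegnerData Dt β ι n),
      KolyvaginDescent.KolSupp (Zhang2014.IsKolyvaginPrime (W.conductorNorm ℤ) W K 3) n ∧
        d.kolyvaginClass Nat.prime_three 1 ≠ 0 := by
  -- road (a): the cyclotomic main conjecture + the two leading terms + Schneider ⟹ BSD(E,3)
  have hbsd : BSDp W 3 :=
    bsdp_of_ram_of_nonsplit_of_regulatorNonvanishing hSkA hJn hHn hD hGZK hpar W 3 hX hram hns hReg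
  -- the converse at the frame
  exact kolyvaginClass_one_ne_zero_of_bsdp_of_hlFrame W K Dt β ι hGZ hKo hSk hGZK hmod hrec h1 h2 hMcU hX hram htam
    hK hodd hH hLt hβ hc hbsd

/-- **The stub AT ONE CURVE from a REG3CERT-shaped rung** — the per-curve reading of the cell's certificate programme for
the Kolyvagin road. For a globally minimal `W` and a rung `hrung : ClassX11b W 3 → Ram W 3 → ¬ split(3) →
ClassClosure.RegulatorNonvanishingAt W 3` (the exact shape of every kernel row `RegMult.Rows.rung_<label> hGZK W hW` of
reg3-eng's REG3CERT batches, `Theorems/ClassRecordThreeRegCertRows*.lean`; 702 rows at the time of writing), the published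
inputs give the conclusion of `stub_zhangFrameHL_nonsplit` at EVERY Hoffstein–Luo frame of `W` — the registered stub
signature with `W` fixed, its curve-level binders (`ClassX11b`, non-split, `Ram`, `3 ∤ ∏c`) feeding `hrung` and §1. So each
kernel REG3CERT row on an A1 curve is, modulo named print only, Kolyvagin's conjecture mod 3 on all HL frames of that
curve — with no Heegner-point computation. CONDITIONAL on the published binders; nothing is booked; one curve per
application. [cite: SteinWuthrich2013, §4.2] [cite: Skinner2016PacificMC, Thm. A (§1)] [cite: McCallumLMS1991, §5 Cor. 5.6] -/
theorem kolyvaginClass_one_ne_zero_allHLFrames_of_regulatorRung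
    (W : WeierstrassCurve ℚ) [W.IsElliptic] [W.IsGloballyMinimal] [NeZero (W.conductorNorm ℤ)]
    -- published inputs: the converse's nine …
    (hGZ : ∀ (K : Type) [Field K] [NumberField K], gross_zagier (W.conductorNorm ℤ) W K)
    (hKo : ∀ (K : Type) [Field K] [NumberField K], kolyvagin (W.conductorNorm ℤ) W K)
    (hSk : thmC_padicValRat_bsd_rank_zero)
    (hGZK : rank_eq_analyticRank_of_analyticRank_le_one) (hmod : hasEntireLFunction_rat)
    (hrec : ∀ (K : Type) [Field K] [NumberField K], heegnerPointOfConductor_one_galoisConj (W.conductorNorm ℤ) W K)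
    (h1 : ∀ (K : Type) [Field K] [NumberField K],
      phi_heegnerPointOfConductor_mem_range_map_ringClassField (W.conductorNorm ℤ) W K)
    (h2 : ∀ (K : Type) [Field K] [NumberField K], exists_generator_ringClassGalOver K)
    (hMcU : McCallum1991_padicValNat_card_sha_primary_add_le_of_globalDivisibility)
    -- … and road (a)'s five
    (hSkA : thmA_charIdeal_multiplicative) (hJn : thm61_nonsplitMultiplicative) (hHn : exists_isMultCanonical)
    (hD : thm1_padicBSD_rankOne_multiplicative) (hpar : nonempty_modularParametrizationData)
    -- ONE REG3CERT-shaped rung at `W`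
    (hrung : ClassX11b W 3 → Ram W 3 → ¬ W.HasSplitMultiplicativeReductionAtPrime 3 →
      ClassClosure.RegulatorNonvanishingAt W 3) :
    ∀ (K : Type) [Field K] [NumberField K] (Dt : ModularParametrizationData W (W.conductorNorm ℤ)) (β : ℤ)
      (ι : K →+* ℂ), ClassX11b W 3 → W.HasMultiplicativeReductionAtPrime 3 →
      ¬ W.HasSplitMultiplicativeReductionAtPrime 3 → Surj W 3 → Ram W 3 → ¬ 3 ∣ W.tamagawaProduct →
      IsImaginaryQuadratic K → Odd (NumberField.discr K) → SatisfiesHeegnerHypothesis (W.conductorNorm ℤ) K →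
      (W.quadraticTwist (NumberField.discr K : ℚ)).entireLFunction 1 ≠ 0 → NumberField.discr K ≠ -3 →
      (4 * (W.conductorNorm ℤ : ℤ)) ∣ β ^ 2 - NumberField.discr K → ¬ (3 : ℤ) ∣ Dt.c →
      ∃ (n : ℕ) (d : KolyvaginHeegnerData Dt β ι n),
        KolyvaginDescent.KolSupp (Zhang2014.IsKolyvaginPrime (W.conductorNorm ℤ) W K 3) n ∧
          d.kolyvaginClass Nat.prime_three 1 ≠ 0 := by
  intro K _ _ Dt β ι hX _hmult hns _hsurj hram htam hK hodd hH hLt _h3 hβ hc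
  exact kolyvaginClass_one_ne_zero_at_hlFrame_of_nonsplit_of_regulatorNonvanishingAt W K Dt β ι (hGZ K) (hKo K) hSk
    hGZK hmod (hrec K) (h1 K) (h2 K) hMcU hSkA hJn hHn hD hpar hX hns hram htam hK hodd hH hLt hβ hc (hrung hX hram hns)

end Summit.BirchSwinnertonDyer.Rank1Residual.X11b.Three.Koly

/-! ## §2 The registered stub `stub_zhangFrameHL_nonsplit` from `ClassRecordThree.SchneiderAtThree` -/

namespace Summit.BirchSwinnertonDyer.BirchSwinnertonDyer.Theorems

open WeierstrassCurve NumberField Literature.NumberTheory.EllipticCurves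
  Literature.NumberTheory.EllipticCurves.ModularForms
  Literature.NumberTheory.EllipticCurves.Rank1Residual
  Literature.NumberTheory.EllipticCurves.Skinner2016
  Literature.NumberTheory.EllipticCurves.SteinWuthrich2013
  Literature.NumberTheory.EllipticCurves.Disegni2020
  Summit.BirchSwinnertonDyer.Rank1Residual Summit.BirchSwinnertonDyer.Rank1Residual.X11b

/-- **The registered stub `stub_zhangFrameHL_nonsplit` (SkeletonHL-v3 on item stmt-BirchSwinnertonDyer-19574) — its
signature VERBATIM as conclusion — from the published inputs and the sister route's crux
`ClassRecordThree.SchneiderAtThree` (item stmt-BirchSwinnertonDyer-19106) BY NAME.** Published inputs as ∀-binders: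
Gross–Zagier `hGZ`, Kolyvagin `hKo`, Skinner 2016 Thm. C `hSk` and Thm. A `hSkA`, GZK `hGZK`, modularity `hmod`,
Shimura reciprocity at conductor 1 `hrec`, Gross 1991 §3 `h1 h2`, McCallum Cor. 5.6 (divisibility half) `hMcU`,
Stein–Wuthrich Thm. 6.1 non-split `hJn` + §4.2 height `hHn`, Disegni 2020 Thm. 1 `hD`, parametrisations `hpar`.
Frame by frame §1; the binder `NumberField.discr K ≠ -3` and `Surj W 3`, multiplicativity at 3 of the stub are not used
(they follow from the others). CONDITIONAL on every binder — in particular on Schneider's conjecture at 3 on the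
non-split (ram) X11b class, which is OPEN —; nothing is booked; the stub is NOT closed by this.
[cite: Skinner2016PacificMC, Thm. A (§1), §3.2] [cite: SteinWuthrich2013, Thm. 6.1 and §4.2] [cite: Disegni2020, Thm. 1]
[cite: McCallumLMS1991, §5 Cor. 5.6] [cite: WZhang2014, Remark 5 and Thm. 10.2] -/
theorem stub_zhangFrameHL_nonsplit_of_schneiderAtThree
    (hGZ : ∀ (N : ℕ) [NeZero N] (W : WeierstrassCurve ℚ) (K : Type) [Field K] [NumberField K],
      gross_zagier N W K)
    (hKo : ∀ (N : ℕ) [NeZero N] (W : WeierstrassCurve ℚ) (K : Type) [Field K] [NumberField K],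
      kolyvagin N W K)
    (hSk : thmC_padicValRat_bsd_rank_zero)
    (hGZK : rank_eq_analyticRank_of_analyticRank_le_one) (hmod : hasEntireLFunction_rat)
    (hrec : ∀ (N : ℕ) [NeZero N] (W : WeierstrassCurve ℚ) (K : Type) [Field K] [NumberField K],
      heegnerPointOfConductor_one_galoisConj N W K)
    (h1 : ∀ (N : ℕ) [NeZero N] (W : WeierstrassCurve ℚ) (K : Type) [Field K] [NumberField K],
      phi_heegnerPointOfConductor_mem_range_map_ringClassField N W K)
    (h2 : ∀ (K : Type) [Field K] [NumberField K], exists_generator_ringClassGalOver K)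
    (hMcU : McCallum1991_padicValNat_card_sha_primary_add_le_of_globalDivisibility)
    (hSkA : thmA_charIdeal_multiplicative) (hJn : thm61_nonsplitMultiplicative) (hHn : exists_isMultCanonical)
    (hD : thm1_padicBSD_rankOne_multiplicative) (hpar : nonempty_modularParametrizationData)
    (hReg : Summit.BirchSwinnertonDyer.BirchSwinnertonDyer.Theses.ClassRecordThree.SchneiderAtThree) :
    -- the registered signature of `stub_zhangFrameHL_nonsplit` (SkeletonHL-v3 on item 19574), fully qualified
    ∀ (W : WeierstrassCurve ℚ) [W.IsElliptic] [W.IsGloballyMinimal] [NeZero (W.conductorNorm ℤ)] (K : Type)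
      [Field K] [NumberField K]
      (Dt : Literature.NumberTheory.EllipticCurves.ModularForms.ModularParametrizationData W (W.conductorNorm ℤ))
      (β : ℤ) (ι : K →+* ℂ), Summit.BirchSwinnertonDyer.Rank1Residual.ClassX11b W 3 →
      W.HasMultiplicativeReductionAtPrime 3 → ¬ W.HasSplitMultiplicativeReductionAtPrime 3 →
      Literature.NumberTheory.EllipticCurves.Rank1Residual.Surj W 3 →
      Literature.NumberTheory.EllipticCurves.Rank1Residual.Ram W 3 → ¬ 3 ∣ W.tamagawaProduct →
      Literature.NumberTheory.EllipticCurves.IsImaginaryQuadratic K → Odd (NumberField.discr K) →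
      Literature.NumberTheory.EllipticCurves.SatisfiesHeegnerHypothesis (W.conductorNorm ℤ) K →
      (W.quadraticTwist (NumberField.discr K : ℚ)).entireLFunction 1 ≠ 0 → NumberField.discr K ≠ -3 →
      (4 * (W.conductorNorm ℤ : ℤ)) ∣ β ^ 2 - NumberField.discr K → ¬ (3 : ℤ) ∣ Dt.c →
      ∃ (n : ℕ) (d : Literature.NumberTheory.EllipticCurves.KolyvaginHeegnerData Dt β ι n),
        Literature.NumberTheory.EllipticCurves.KolyvaginDescent.KolSupp
            (Literature.NumberTheory.EllipticCurves.Zhang2014.IsKolyvaginPrime (W.conductorNorm ℤ) W K 3) n ∧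
          d.kolyvaginClass Nat.prime_three 1 ≠ 0 := by
  intro W _ _ _ K _ _ Dt β ι hX _hmult hns _hsurj hram htam hK hodd hH hLt _h3 hβ hc
  exact Summit.BirchSwinnertonDyer.Rank1Residual.X11b.Three.Koly.kolyvaginClass_one_ne_zero_at_hlFrame_of_nonsplit_of_regulatorNonvanishingAt
    W K Dt β ι (hGZ _ W K) (hKo _ W K) hSk hGZK hmod (hrec _ W K) (h1 _ W K) (h2 K) hMcU hSkA hJn hHn hD hpar
    hX hns hram htam hK hodd hH hLt hβ hc (hReg W hX hram hns)

/-- **The same, keyed on the route's own conjunction `PublishedInputsKolyThree`** (item 19156; its conjuncts 1, 2, 4,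
6, 7, 14–18 and the conductor-1 Galois-conjugation record are used) plus the three published facts it does not list
(Gross 1991 §3: `phi_heegnerPointOfConductor_mem_range_map_ringClassField`, `exists_generator_ringClassGalOver`;
McCallum 1991 Cor. 5.6's divisibility half) and `ClassRecordThree.SchneiderAtThree` BY NAME. For the owner's `_of`:
the non-split stub is `PublishedInputsKolyThree ∧ (Gross §3 ×2) ∧ (McCallum div.) ∧ SchneiderAtThree`-conditional.
CONDITIONAL on every binder; nothing is booked. [cite: Skinner2016PacificMC, Thm. A (§1)]
[cite: McCallumLMS1991, §5 Cor. 5.6] [cite: GrossLMS1991, §3 (3.1)–(3.3)] -/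
theorem stub_zhangFrameHL_nonsplit_of_publishedInputsKolyThree_of_schneiderAtThree
    (hPub : Summit.BirchSwinnertonDyer.BirchSwinnertonDyer.Theses.KolyvaginRoadThree.PublishedInputsKolyThree)
    (h1 : ∀ (N : ℕ) [NeZero N] (W : WeierstrassCurve ℚ) (K : Type) [Field K] [NumberField K],
      phi_heegnerPointOfConductor_mem_range_map_ringClassField N W K)
    (h2 : ∀ (K : Type) [Field K] [NumberField K], exists_generator_ringClassGalOver K)
    (hMcU : McCallum1991_padicValNat_card_sha_primary_add_le_of_globalDivisibility)
    (hReg : Summit.BirchSwinnertonDyer.BirchSwinnertonDyer.Theses.ClassRecordThree.SchneiderAtThree) :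
    ∀ (W : WeierstrassCurve ℚ) [W.IsElliptic] [W.IsGloballyMinimal] [NeZero (W.conductorNorm ℤ)] (K : Type)
      [Field K] [NumberField K]
      (Dt : Literature.NumberTheory.EllipticCurves.ModularForms.ModularParametrizationData W (W.conductorNorm ℤ))
      (β : ℤ) (ι : K →+* ℂ), Summit.BirchSwinnertonDyer.Rank1Residual.ClassX11b W 3 →
      W.HasMultiplicativeReductionAtPrime 3 → ¬ W.HasSplitMultiplicativeReductionAtPrime 3 →
      Literature.NumberTheory.EllipticCurves.Rank1Residual.Surj W 3 →
      Literature.NumberTheory.EllipticCurves.Rank1Residual.Ram W 3 → ¬ 3 ∣ W.tamagawaProduct →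
      Literature.NumberTheory.EllipticCurves.IsImaginaryQuadratic K → Odd (NumberField.discr K) →
      Literature.NumberTheory.EllipticCurves.SatisfiesHeegnerHypothesis (W.conductorNorm ℤ) K →
      (W.quadraticTwist (NumberField.discr K : ℚ)).entireLFunction 1 ≠ 0 → NumberField.discr K ≠ -3 →
      (4 * (W.conductorNorm ℤ : ℤ)) ∣ β ^ 2 - NumberField.discr K → ¬ (3 : ℤ) ∣ Dt.c →
      ∃ (n : ℕ) (d : Literature.NumberTheory.EllipticCurves.KolyvaginHeegnerData Dt β ι n),
        Literature.NumberTheory.EllipticCurves.KolyvaginDescent.KolSupp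
            (Literature.NumberTheory.EllipticCurves.Zhang2014.IsKolyvaginPrime (W.conductorNorm ℤ) W K 3) n ∧
          d.kolyvaginClass Nat.prime_three 1 ≠ 0 := by
  obtain ⟨⟨hGZ, hKo, -, hSk, -, hGZK, hmod, -, -, -, -, -, -, hSkA, hJn, hHn, hD, hpar, -, -⟩, -, hrec, -⟩ := hPub
  exact stub_zhangFrameHL_nonsplit_of_schneiderAtThree hGZ hKo hSk hGZK hmod hrec h1 h2 hMcU hSkA hJn hHn hD hpar hReg

end Summit.BirchSwinnertonDyer.BirchSwinnertonDyer.Theorems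

/-! ## §3 The BC5 rung `stub_rung_347253a1` from the published inputs ALONE -/

namespace Summit.BirchSwinnertonDyer.Rank1Residual.X11b.Three.Koly.Rung347253a1

open WeierstrassCurve NumberField Literature.NumberTheory.EllipticCurves
  Literature.NumberTheory.EllipticCurves.ModularForms
  Literature.NumberTheory.EllipticCurves.Rank1Residual
  Literature.NumberTheory.EllipticCurves.Skinner2016
  Literature.NumberTheory.EllipticCurves.SteinWuthrich2013
  Literature.NumberTheory.EllipticCurves.Disegni2020
  Summit.BirchSwinnertonDyer.Rank1Residual Summit.BirchSwinnertonDyer.Rank1Residual.X11b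
  Summit.BirchSwinnertonDyer.BirchSwinnertonDyer.Rank1Residual

/-- **Cremona 347253a1 is NON-SPLIT multiplicative at 3** (kernel arithmetic on the integer model
`E₀ = [0, −1, 1, −10493, 412556]`, which IS the tree's integral model of the globally minimal `W`): `3 ∣ Δ(E₀) =
1660900334157`, `3 ∤ c₄(E₀) = 503680`, and the node-tangent quadratic `c₄ X² + a₁c₄ X − (54 b₆ − 3 b₂ b₄ + a₂ c₄)`
reduces to `X² + 1` over `𝔽₃`, which has no root (Silverman, *AEC* VII.5.1(b); tree
`IntModel.not_hasSplitMultiplicativeReductionAtPrime_of_intModel_of_noroot`). [cite: SilvermanAEC2009, VII.5 Prop. 5.1(b)] -/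
theorem not_hasSplitMultiplicativeReductionAtPrime_three (W : WeierstrassCurve ℚ)
    (hW : W = ⟨0, -1, 1, -10493, 412556⟩) [W.IsElliptic] [W.IsGloballyMinimal] :
    ¬ W.HasSplitMultiplicativeReductionAtPrime 3 := by
  have hI : integralModelInt W = (⟨0, -1, 1, -10493, 412556⟩ : WeierstrassCurve ℤ) :=
    IntModel.integralModelInt_eq_of_map_eq _ (by rw [hW]; ext <;> simp [WeierstrassCurve.map])
  have hΔ : (⟨0, -1, 1, -10493, 412556⟩ : WeierstrassCurve ℤ).Δ = 1660900334157 := by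
    norm_num [WeierstrassCurve.Δ, WeierstrassCurve.b₂, WeierstrassCurve.b₄, WeierstrassCurve.b₆,
      WeierstrassCurve.b₈]
  have hc₄ : (⟨0, -1, 1, -10493, 412556⟩ : WeierstrassCurve ℤ).c₄ = 503680 := by
    norm_num [WeierstrassCurve.c₄, WeierstrassCurve.b₂, WeierstrassCurve.b₄]
  have hb₂ : (⟨0, -1, 1, -10493, 412556⟩ : WeierstrassCurve ℤ).b₂ = -4 := by
    norm_num [WeierstrassCurve.b₂]
  have hb₄ : (⟨0, -1, 1, -10493, 412556⟩ : WeierstrassCurve ℤ).b₄ = -20986 := by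
    norm_num [WeierstrassCurve.b₄]
  have hb₆ : (⟨0, -1, 1, -10493, 412556⟩ : WeierstrassCurve ℤ).b₆ = 1650225 := by
    norm_num [WeierstrassCurve.b₆]
  refine IntModel.not_hasSplitMultiplicativeReductionAtPrime_of_intModel_of_noroot hI 3
    (by rw [hΔ]; norm_num) (by rw [hc₄]; norm_num) ?_
  intro t
  rw [hc₄, hb₂, hb₄, hb₆]
  revert t
  decide

/-- **The BC5 rung `stub_rung_347253a1` — its registered signature VERBATIM as conclusion — from the PUBLISHED inputs
ALONE.** For `W = ⟨0,−1,1,−10493,412556⟩` (Cremona 347253a1, a NON-SPLIT A1 curve): EVERY field with `d_K = −11`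
(indeed the value `−11` is not used) and EVERY Manin-good frame `(Dt, β, ι)` carries a Kolyvagin–Heegner datum of
Kolyvagin-prime conductor with `c₁(n) ≠ 0 in H¹(K, E[3])`. Inputs: the fourteen published named facts of §1 as binders
and NOTHING ELSE — Schneider's non-degeneracy at `(347253a1, 3)` is the KERNEL theorem `RegMult.Rows.rung_347253a1`
(reg3-eng, REG3CERT batch 08: the 3-adic height certificate of `Q = 4·P` checked in the kernel), non-split at 3 is
`not_hasSplitMultiplicativeReductionAtPrime_three`, and the curve-level binders of the stub (`ClassX11b W 3`, `Ram W 3`,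
`¬ 3 ∣ ∏c`) arrive inside the conclusion. Compare `rung_347253a1_of_cert` (one ATTESTED Kolyvagin certificate, kit
j249662) and `rung_347253a1_of_shaAn_unit` (the attested exact `#Ш_an`): here no attested datum remains. CONDITIONAL on
the published binders; nothing is booked; a rung is ONE curve and closes nothing by itself.
[cite: Skinner2016PacificMC, Thm. A (§1), §3.2] [cite: SteinWuthrich2013, Thm. 6.1 and §4.2] [cite: Disegni2020, Thm. 1]
[cite: McCallumLMS1991, §5 Lemma 5.1 and Cor. 5.6] [cite: WZhang2014, Remark 5 and Thm. 10.2] -/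
theorem rung_347253a1_of_published (W : WeierstrassCurve ℚ) (hW : W = ⟨0, -1, 1, -10493, 412556⟩)
    [W.IsElliptic] [W.IsGloballyMinimal] [NeZero (W.conductorNorm ℤ)]
    -- published inputs (named facts of the tree): the converse's nine …
    (hGZ : ∀ (K : Type) [Field K] [NumberField K], gross_zagier (W.conductorNorm ℤ) W K)
    (hKo : ∀ (K : Type) [Field K] [NumberField K], kolyvagin (W.conductorNorm ℤ) W K)
    (hSk : thmC_padicValRat_bsd_rank_zero)
    (hGZK : rank_eq_analyticRank_of_analyticRank_le_one) (hmod : hasEntireLFunction_rat)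
    (hrec : ∀ (K : Type) [Field K] [NumberField K], heegnerPointOfConductor_one_galoisConj (W.conductorNorm ℤ) W K)
    (h1 : ∀ (K : Type) [Field K] [NumberField K],
      phi_heegnerPointOfConductor_mem_range_map_ringClassField (W.conductorNorm ℤ) W K)
    (h2 : ∀ (K : Type) [Field K] [NumberField K], exists_generator_ringClassGalOver K)
    (hMcU : McCallum1991_padicValNat_card_sha_primary_add_le_of_globalDivisibility)
    -- … and road (a)'s five
    (hSkA : thmA_charIdeal_multiplicative) (hJn : thm61_nonsplitMultiplicative) (hHn : exists_isMultCanonical)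
    (hD : thm1_padicBSD_rankOne_multiplicative) (hpar : nonempty_modularParametrizationData) :
    -- the registered signature of `stub_rung_347253a1` (SkeletonHL-v3 on item 19574), `W347253a1 := W`
    ∀ (K : Type) [Field K] [NumberField K] (Dt : ModularParametrizationData W (W.conductorNorm ℤ)) (β : ℤ)
      (ι : K →+* ℂ), ClassX11b W 3 → W.HasMultiplicativeReductionAtPrime 3 → Surj W 3 → Ram W 3 →
      ¬ 3 ∣ W.tamagawaProduct → IsImaginaryQuadratic K → Odd (NumberField.discr K) →
      SatisfiesHeegnerHypothesis (W.conductorNorm ℤ) K →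
      (W.quadraticTwist (NumberField.discr K : ℚ)).entireLFunction 1 ≠ 0 → NumberField.discr K = -11 →
      (4 * (W.conductorNorm ℤ : ℤ)) ∣ β ^ 2 - NumberField.discr K → ¬ (3 : ℤ) ∣ Dt.c →
      ∃ (n : ℕ) (d : KolyvaginHeegnerData Dt β ι n),
        KolyvaginDescent.KolSupp (Zhang2014.IsKolyvaginPrime (W.conductorNorm ℤ) W K 3) n ∧
          d.kolyvaginClass Nat.prime_three 1 ≠ 0 := by
  intro K _ _ Dt β ι hX _hmult _hsurj hram htam hK hodd hH hLt _hd hβ hc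
  -- kernel: 347253a1 is non-split at 3; REG3CERT batch 08: Schneider at (347253a1, 3) is a kernel theorem
  have hns : ¬ W.HasSplitMultiplicativeReductionAtPrime 3 := not_hasSplitMultiplicativeReductionAtPrime_three W hW
  have hReg : ClassClosure.RegulatorNonvanishingAt W 3 := RegMult.Rows.rung_347253a1 hGZK W hW hX hram hns
  exact kolyvaginClass_one_ne_zero_at_hlFrame_of_nonsplit_of_regulatorNonvanishingAt W K Dt β ι (hGZ K) (hKo K) hSk
    hGZK hmod (hrec K) (h1 K) (h2 K) hMcU hSkA hJn hHn hD hpar hX hns hram htam hK hodd hH hLt hβ hc hReg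

end Summit.BirchSwinnertonDyer.Rank1Residual.X11b.Three.Koly.Rung347253a1

end
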